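import Summits.QuantumFields.BalabanUV.Beta.EriceRemainderEnclosureHistoryAutonomyComparisonAgeCompositionGeometricCover

/-!
# EriceRemainderEnclosureHistoryAutonomyComparisonAgeCompositionGeometricCoverTiers — (E114f) THE TWO-CONSTANT GEOMETRIC COVER: SHALLOW EQUATIONS COVER OLD
# COLUMNS AT (NEARLY) FULL STRENGTH.  (E114c) uses ONE domination factor `r` for every pair (deeper equation `n+1+j`, column `n+1+l`); along a flow `r = 2^{−3∕2}` is
# forced by the boundary pairs `j ≈ l ≈ k` although a SHALLOW equation (`j < l₀`) reads an OLD column (`l ≥ l₁ ≫ l₀`) almost as strongly as row `n` itself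
# (`(a_{m+k}∕a_{m+k+1+j})^{3∕2} ≥ ((l₁+1)∕(l₁+1+l₀))^{3∕2} =: s ≈ 1`).  This file adds the second constant: with `r` everywhere and `s ≥ r` for the pairs `j < l₀`,
# `l ≥ l₁` (`l₀ ≤ l₁`), the weights
#     `λ_l = K n l·P_l` (`l < l₁`),   `λ_l = K n l·c·Q_l` (`l ≥ l₁`),   `P_l = Π_{i<l}(1 − rK n i)`, `Q_l = Π_{l₁≤i<l}(1 − rK n i)`,
#     `c = 1 − s·Λ⁰ − r·(Λ¹ − Λ⁰)`,  `Λ⁰ = (1 − P_{l₀})∕r`, `Λ¹ = (1 − P_{l₁})∕r`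
# cover row `n` EXACTLY (**`tier_weights_cover_old`**; the young part is (E114c)'s `geom_weights_cover`), with total mass `Λ¹ + c·(1 − Q_N)∕r`; hence
# **`sol_nonneg_le_of_two_constant_cover`**: `0 ≤ t ≤ w` as soon as `c ≥ 0` and `Λ¹ + c·(1 − Q_N)∕r ≤ 1` at every pin.  READING (README
# `HOME/b2b-balaban-beta-d4-p2/g95/README.md` §5–§6): the young block's diagonal weights (`Λ⁰ ≈` the young load `Y`) now count with `s` instead of `r` on the old
# columns, so for an old-dominated profile the criterion is `≈ Λ⁰ + (1 − sΛ⁰)(1 − e^{−rT_old})∕r ≤ 1` (`Λ⁰ ≈ (1 − e^{−rY})∕r`, `Y` the young load) — with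
# `s = (7∕8)^{3∕2}` (`l₁ = 7l₀`) and `Y ≈ 0.34` this reaches `T ≈ 1.45` on the old-only frontier (K ≈ 2^36; ≈ 2^32 for dense profiles, `Y ≈ 0.55`, `T ≈ 1.55`) against
# `1.18` for (E114e) and `1` for the light load; it is the mechanism behind the LP-optimal covers of README §5.
# The flow-level instance (s from (E58b) concavity exactly as (E114d)'s `r`) is the successor's.

Cell `pub-balaban`, β-function sub-cell, BINDER row D4 «RemainderConst leaves for Bałaban's split» (`HOME/BINDER-OWNERS.md`; owner lineage `b2b-balaban-beta-an4`;
this file by co-owner #2 lineage `b2b-balaban-beta-d4-p2`, generation 95), β-FLOW TEAM duty (1), FREEZE (0) honoured (def-free; imports (E114c); uses (E114c)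
`cover_of_entrywise`, `geom_weights_sum`, `geom_weights_cover`, (E113a) `sol_nonneg_le_of_cover` BY NAME; abstract renewal language, no flows).

HONEST FRAMING (page 1, verbatim and binding).  *"Discharging BetaPertH makes Bałaban's UV stability UNCONDITIONAL — a real constructive-QFT result; it is
NOT the continuum limit and NOT the Clay problem."*  THIS FILE DISCHARGES NOTHING OF THE KIND.  Elementary linear algebra ∕ real analysis about ABSTRACT
triangular systems — hypotheses of a census, not facts; the form, signs, ages and moments of Bałaban's (1.22) limit functional are NOT PRINTED ([I] p. 298;
GAPS G-t4-U2-1∕-2) and NOT asserted.  Row D4 class UNCHANGED (critical-path width 0; instance 0∕1; D4 DISCHARGE NO DATE).  HONEST DEPENDENCY: continuum YM on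
T⁴ ⇐ BetaPertH ∧ nine spine estimates (0/9 proved); BetaPertH ⇐ (D1) ∧ (D4) ∧ CAP+tail; G-an2-4 gates asym, D1 and NE2/3/4.

NOT CLAIMED: any statement about flows; that covers reach every range (README §5: undecided — the LP-optimal cover has mass 0.81 at K = 10¹² and gains ≈ 0.007 per
octave against T's 0.029); anything printed — NOT B12 Thm 2, NOT BetaPertH.

WHAT IS PROVED ([folklore]; 0 `def`, 0 sorry).  §1 `geom_weights_sum_Ico`, **`tier_weights_cover_old`**.  §2 **`sol_nonneg_le_of_two_constant_cover`**.
-/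
noncomputable section
open Finset

namespace Summit.QuantumFields.BalabanUV.Beta.EriceRemainderEnclosureHistoryAutonomyComparisonAgeCompositionGeometricCoverTiers

open Summit.QuantumFields.BalabanUV.Beta.EriceRemainderEnclosureHistoryAutonomyComparisonAgeCompositionRowCertificate (sol_nonneg_le_of_cover)
open Summit.QuantumFields.BalabanUV.Beta.EriceRemainderEnclosureHistoryAutonomyComparisonAgeCompositionGeometricCover
  (cover_of_entrywise geom_weights_sum geom_weights_cover)

variable {N : ℕ} {K : ℕ → ℕ → ℝ} {R : (ℕ → ℝ) → ℕ → ℝ}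

/-! ## §1 The weights on the old columns -/

/-- The geometric identity on a shifted range: `r·Σ_{j∈[a,b)} t_j·Π_{i∈[a,j)}(1 − r t_i) = 1 − Π_{i∈[a,b)}(1 − r t_i)` (`a ≤ b`). [folklore] -/
theorem geom_weights_sum_Ico (t : ℕ → ℝ) (r : ℝ) {a b : ℕ} (hab : a ≤ b) :
    r * ∑ j ∈ Ico a b, t j * ∏ i ∈ Ico a j, (1 - r * t i) = 1 - ∏ i ∈ Ico a b, (1 - r * t i) := by
  induction b, hab using Nat.le_induction with
  | base => simp
  | succ b hab ih => rw [sum_Ico_succ_top hab, mul_add, ih, prod_Ico_succ_top hab]; ring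

/-- **THE OLD COLUMNS ARE COVERED EXACTLY.**  For `l₁ ≤ l`, with `Λ⁰`, `Λ¹` the young sums and `c = 1 − sΛ⁰ − r(Λ¹ − Λ⁰)`:
`t_l·c·Q_l + s·t_l·Λ⁰ + r·t_l·(Λ¹ − Λ⁰) + (Σ_{j∈[l₁,l)} t_j·c·Q_j)·(r·t_l) = t_l`. [folklore] -/
theorem tier_weights_cover_old (t : ℕ → ℝ) (r s Λ0 Λ1 : ℝ) {l₁ l : ℕ} (hl : l₁ ≤ l) :
    t l * (1 - s * Λ0 - r * (Λ1 - Λ0)) * ∏ i ∈ Ico l₁ l, (1 - r * t i) + s * t l * Λ0 + r * t l * (Λ1 - Λ0)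
      + (∑ j ∈ Ico l₁ l, t j * (1 - s * Λ0 - r * (Λ1 - Λ0)) * ∏ i ∈ Ico l₁ j, (1 - r * t i)) * (r * t l) = t l := by
  have h := geom_weights_sum_Ico t r hl
  have e : (∑ j ∈ Ico l₁ l, t j * (1 - s * Λ0 - r * (Λ1 - Λ0)) * ∏ i ∈ Ico l₁ j, (1 - r * t i)) * (r * t l)
      = t l * (1 - s * Λ0 - r * (Λ1 - Λ0)) * (1 - ∏ i ∈ Ico l₁ l, (1 - r * t i)) := by
    rw [← h, mul_sum, mul_sum, sum_mul]
    exact sum_congr rfl fun j _ => by ring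
  rw [e]; ring

/-! ## §2 Positivity by the two-constant cover -/

/-- **POSITIVITY BY THE TWO-CONSTANT GEOMETRIC COVER.**  Kernel `K ≥ 0` with reads `R`; thresholds `l₀ ≤ l₁`; constants `0 < r`, `s` with `r·K n l ≤ 1`;
DOMINATION: `r·K n l ≤ K (n+1+j) (l−1−j)` for all `j < l < N`, and `s·K n l ≤ K (n+1+j) (l−1−j)` for the shallow equations on the old columns, `j < l₀`, `l₁ ≤ l < N`.
With `P n l = Π_{i<l}(1 − r·K n i)`, `Λ⁰ n = (1 − P n l₀)∕r`, `Λ¹ n = (1 − P n l₁)∕r`, `c n = 1 − s·Λ⁰ n − r·(Λ¹ n − Λ⁰ n)` and `Q n = Π_{i∈[l₁,N)}(1 − r·K n i)`: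
IF `0 ≤ c n` and `Λ¹ n + c n·(1 − Q n)∕r ≤ 1` at every pin, THEN the zero-tailed solution of `t = w − R t` (`w ≥ 0` non-increasing) satisfies `0 ≤ t n ≤ w n`.
[folklore] -/
theorem sol_nonneg_le_of_two_constant_cover (hR : ∀ v n, R v n = ∑ l ∈ range N, K n l * v (n + 1 + l)) (hK : ∀ n l, 0 ≤ K n l)
    {r s : ℝ} (hr0 : 0 < r) (hrt : ∀ n l, r * K n l ≤ 1) {l₀ l₁ : ℕ} (h01 : l₀ ≤ l₁)
    (hdom : ∀ n j l, j < l → l < N → r * K n l ≤ K (n + 1 + j) (l - 1 - j))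
    (hdomS : ∀ n j l, j < l₀ → l₁ ≤ l → l < N → s * K n l ≤ K (n + 1 + j) (l - 1 - j))
    {c : ℕ → ℝ}
    (hc : ∀ n, c n = 1 - s * ((1 - ∏ i ∈ range l₀, (1 - r * K n i)) / r)
      - r * ((1 - ∏ i ∈ range l₁, (1 - r * K n i)) / r - (1 - ∏ i ∈ range l₀, (1 - r * K n i)) / r))
    (hc0 : ∀ n, 0 ≤ c n)
    (hcrit : ∀ n, (1 - ∏ i ∈ range l₁, (1 - r * K n i)) / r + c n * (1 - ∏ i ∈ Ico l₁ N, (1 - r * K n i)) / r ≤ 1)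
    {w t : ℕ → ℝ} (hw0 : ∀ n, 0 ≤ w n) (hanti : ∀ n, w (n + 1) ≤ w n)
    (htail : ∀ n, N < n → t n = 0) (hrec : ∀ n, t n = w n - R t n) : ∀ n, 0 ≤ t n ∧ t n ≤ w n := by
  -- the weights
  set lam : ℕ → ℕ → ℝ := fun n l =>
    if l < l₁ then K n l * ∏ i ∈ range l, (1 - r * K n i) else K n l * c n * ∏ i ∈ Ico l₁ l, (1 - r * K n i) with hlam
  have hfac : ∀ n i, 0 ≤ 1 - r * K n i := fun n i => by linarith [hrt n i]
  have hP0 : ∀ n l, 0 ≤ ∏ i ∈ range l, (1 - r * K n i) := fun n l => prod_nonneg fun i _ => hfac n i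
  have hQ0 : ∀ n l, 0 ≤ ∏ i ∈ Ico l₁ l, (1 - r * K n i) := fun n l => prod_nonneg fun i _ => hfac n i
  have hlam0 : ∀ n l, 0 ≤ lam n l := fun n l => by
    simp only [hlam]; split_ifs
    · exact mul_nonneg (hK n l) (hP0 n l)
    · exact mul_nonneg (mul_nonneg (hK n l) (hc0 n)) (hQ0 n l)
  -- abbreviations for one pin
  have hyoung : ∀ n l, l < l₁ → lam n l = K n l * ∏ i ∈ range l, (1 - r * K n i) := fun n l hl => by simp only [hlam, if_pos hl]
  have hold : ∀ n l, l₁ ≤ l → lam n l = K n l * c n * ∏ i ∈ Ico l₁ l, (1 - r * K n i) := fun n l hl => by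
    simp only [hlam, if_neg (not_lt.mpr hl)]
  refine sol_nonneg_le_of_cover hR hK (lam := lam) hlam0 (fun n => ?_) ?_ hw0 hanti htail hrec
  · -- total mass
    rcases Nat.lt_or_ge N l₁ with hN | hN
    · -- everything is young: mass ≤ Λ¹-type bound ≤ (1 − P_N)/r ≤ ... use the young identity up to N and P_N ≥ P_{l₁}·?  Simpler: (1 − P_N)/r ≤ (1 − P_{l₁})/r ≤ 1.
      have hsum : ∑ j ∈ range N, lam n j = ∑ j ∈ range N, K n j * ∏ i ∈ range j, (1 - r * K n i) :=
        sum_congr rfl fun j hj => hyoung n j (by have := mem_range.mp hj; omega)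
      have h1 := geom_weights_sum (K n) r N
      have h2 := geom_weights_sum (K n) r l₁
      -- `P` is non-increasing in the number of factors: `N < l₁ ⇒ P_{l₁} ≤ P_N`
      have hmono : ∏ i ∈ range l₁, (1 - r * K n i) ≤ ∏ i ∈ range N, (1 - r * K n i) := by
        rw [← prod_range_mul_prod_Ico _ hN.le]
        exact mul_le_of_le_one_right (hP0 n N) (prod_le_one (fun i _ => hfac n i) fun i _ => by
          have := mul_nonneg hr0.le (hK n i); linarith)
      have hcn := hc0 n
      have hQ1 : ∏ i ∈ Ico l₁ N, (1 - r * K n i) ≤ 1 := prod_le_one (fun i _ => hfac n i) fun i _ => by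
        have := mul_nonneg hr0.le (hK n i); linarith
      have hcr := hcrit n
      rw [hsum]
      -- r * S_N = 1 − P_N ≤ 1 − P_{l₁} and (1 − P_{l₁})/r ≤ 1 − c(1−Q)/r ≤ 1
      have hA : r * ∑ j ∈ range N, K n j * ∏ i ∈ range j, (1 - r * K n i) ≤ 1 - ∏ i ∈ range l₁, (1 - r * K n i) := by rw [h1]; linarith
      have hB : (1 - ∏ i ∈ range l₁, (1 - r * K n i)) / r ≤ 1 := by
        have : 0 ≤ c n * (1 - ∏ i ∈ Ico l₁ N, (1 - r * K n i)) / r := div_nonneg (mul_nonneg hcn (by linarith)) hr0.le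
        linarith
      rw [div_le_iff₀ hr0] at hB
      by_contra hS; rw [not_le] at hS
      have := mul_lt_mul_of_pos_left hS hr0
      linarith
    · -- young part + old part
      rw [← sum_range_add_sum_Ico _ hN]
      have hsumY : ∑ j ∈ range l₁, lam n j = ∑ j ∈ range l₁, K n j * ∏ i ∈ range j, (1 - r * K n i) :=
        sum_congr rfl fun j hj => hyoung n j (mem_range.mp hj)
      have hsumO : ∑ j ∈ Ico l₁ N, lam n j = c n * ∑ j ∈ Ico l₁ N, K n j * ∏ i ∈ Ico l₁ j, (1 - r * K n i) := by
        rw [mul_sum]; exact sum_congr rfl fun j hj => by rw [hold n j (mem_Ico.mp hj).1]; ring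
      have h1 := geom_weights_sum (K n) r l₁
      have h2 := geom_weights_sum_Ico (K n) r hN
      have hcr := hcrit n
      rw [hsumY, hsumO]
      -- Λ¹ = (1 − P_{l₁})/r, old = c (1 − Q)/r
      have eY : ∑ j ∈ range l₁, K n j * ∏ i ∈ range j, (1 - r * K n i) = (1 - ∏ i ∈ range l₁, (1 - r * K n i)) / r := by
        rw [← h1]; field_simp
      have eO : ∑ j ∈ Ico l₁ N, K n j * ∏ i ∈ Ico l₁ j, (1 - r * K n i) = (1 - ∏ i ∈ Ico l₁ N, (1 - r * K n i)) / r := by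
        rw [← h2]; field_simp
      rw [eY, eO, ← mul_div_assoc]
      exact hcr
  · -- the entrywise cover
    refine cover_of_entrywise hR hK hlam0 (fun n l hl => ?_)
    rcases Nat.lt_or_ge l l₁ with hl1 | hl1
    · -- young column: (E114c)'s exact geometric cover with `r`
      rw [hyoung n l hl1]
      have hcov := geom_weights_cover (K n) r l
      calc K n l = K n l * ∏ i ∈ range l, (1 - r * K n i)
            + (∑ j ∈ range l, K n j * ∏ i ∈ range j, (1 - r * K n i)) * (r * K n l) := hcov.symm
        _ = K n l * ∏ i ∈ range l, (1 - r * K n i) + ∑ j ∈ range l, (K n j * ∏ i ∈ range j, (1 - r * K n i)) * (r * K n l) := by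
            rw [sum_mul]
        _ ≤ K n l * ∏ i ∈ range l, (1 - r * K n i) + ∑ j ∈ range l, lam n j * K (n + 1 + j) (l - 1 - j) := by
            refine add_le_add le_rfl (sum_le_sum fun j hj => ?_)
            have hj := mem_range.mp hj
            rw [hyoung n j (by omega)]
            exact mul_le_mul_of_nonneg_left (hdom n j l hj hl) (mul_nonneg (hK n j) (hP0 n j))
    · -- old column: shallow equations with `s`, middle with `r`, old with `r` and the factor `c`
      rw [hold n l hl1]
      have hcov := tier_weights_cover_old (K n) r s ((1 - ∏ i ∈ range l₀, (1 - r * K n i)) / r)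
        ((1 - ∏ i ∈ range l₁, (1 - r * K n i)) / r) hl1
      rw [← hc n] at hcov
      -- split the sum over `j < l` into `[0,l₀) ∪ [l₀,l₁) ∪ [l₁,l)`
      have hsplit : ∑ j ∈ range l, lam n j * K (n + 1 + j) (l - 1 - j)
          = ∑ j ∈ range l₀, lam n j * K (n + 1 + j) (l - 1 - j) + ∑ j ∈ Ico l₀ l₁, lam n j * K (n + 1 + j) (l - 1 - j)
            + ∑ j ∈ Ico l₁ l, lam n j * K (n + 1 + j) (l - 1 - j) := by
        rw [← sum_range_add_sum_Ico _ hl1, ← sum_range_add_sum_Ico _ h01]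
      -- the three lower bounds
      have hS : s * K n l * ((1 - ∏ i ∈ range l₀, (1 - r * K n i)) / r) ≤ ∑ j ∈ range l₀, lam n j * K (n + 1 + j) (l - 1 - j) := by
        have e : s * K n l * ((1 - ∏ i ∈ range l₀, (1 - r * K n i)) / r)
            = ∑ j ∈ range l₀, (K n j * ∏ i ∈ range j, (1 - r * K n i)) * (s * K n l) := by
          rw [← geom_weights_sum (K n) r l₀, ← sum_mul]; field_simp
        rw [e]
        refine sum_le_sum fun j hj => ?_
        have hj := mem_range.mp hj
        rw [hyoung n j (by omega)]
        exact mul_le_mul_of_nonneg_left (hdomS n j l hj hl1 hl) (mul_nonneg (hK n j) (hP0 n j))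
      have hM : r * K n l * ((1 - ∏ i ∈ range l₁, (1 - r * K n i)) / r - (1 - ∏ i ∈ range l₀, (1 - r * K n i)) / r)
          ≤ ∑ j ∈ Ico l₀ l₁, lam n j * K (n + 1 + j) (l - 1 - j) := by
        have e1 := geom_weights_sum (K n) r l₁
        have e0 := geom_weights_sum (K n) r l₀
        have e : r * K n l * ((1 - ∏ i ∈ range l₁, (1 - r * K n i)) / r - (1 - ∏ i ∈ range l₀, (1 - r * K n i)) / r)
            = ∑ j ∈ Ico l₀ l₁, (K n j * ∏ i ∈ range j, (1 - r * K n i)) * (r * K n l) := by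
          rw [← sum_range_add_sum_Ico _ h01] at e1
          rw [← sum_mul]
          have : ∑ j ∈ Ico l₀ l₁, K n j * ∏ i ∈ range j, (1 - r * K n i)
              = ((1 - ∏ i ∈ range l₁, (1 - r * K n i)) - (1 - ∏ i ∈ range l₀, (1 - r * K n i))) / r := by
            rw [← e1, ← e0]; field_simp; ring
          rw [this]; field_simp
        rw [e]
        refine sum_le_sum fun j hj => ?_
        have hj := mem_Ico.mp hj
        rw [hyoung n j hj.2]
        exact mul_le_mul_of_nonneg_left (hdom n j l (by omega) hl) (mul_nonneg (hK n j) (hP0 n j))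
      have hO : (∑ j ∈ Ico l₁ l, K n j * c n * ∏ i ∈ Ico l₁ j, (1 - r * K n i)) * (r * K n l)
          ≤ ∑ j ∈ Ico l₁ l, lam n j * K (n + 1 + j) (l - 1 - j) := by
        rw [sum_mul]
        refine sum_le_sum fun j hj => ?_
        have hj := mem_Ico.mp hj
        rw [hold n j hj.1]
        exact mul_le_mul_of_nonneg_left (hdom n j l hj.2 hl) (mul_nonneg (mul_nonneg (hK n j) (hc0 n)) (hQ0 n j))
      rw [hsplit]
      have hcov' := hcov
      -- assemble
      nlinarith [hcov', hS, hM, hO, hK n l]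

end Summit.QuantumFields.BalabanUV.Beta.EriceRemainderEnclosureHistoryAutonomyComparisonAgeCompositionGeometricCoverTiers

end
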